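/-
Copyright (c) 2026 the pub-hodgecm-mathlib formalisation cell (harness21).  Prover seat hodgecm-mathlib-LH7-p02 (g6): LH4-plan (g6) WORD #99 price-list item (P8b)
«T5-u AT EVERY NON-SPLIT PLACE» — the de-`h2` twin of ★ T5-u-TAME (`FinExplicitTransferFactorDeepTauTame{,Pairs}`, F0P3a-p04 (g16)); LH5-p01 (g5) census
`CENSUS-DRAM-h2.v1` 3989fe6bdd514291 §1 M4 ∕ §3 (d3); 2026-09-02.
-/
import Literature.NumberTheory.Rogawski1990.FinExplicitTransferFactorDeepTauTamePairs   -- ★ T5-u-TAME + sequel: every `h2`-free supplier used below, and the TAME heads this file generalises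
import HarnessLib

/-!
# `τ_v(γ_H) = (β(γ_H), θ)_v` for EVERY deep `γ_H ∈ H_v` at EVERY non-split place — dyadic places included
# ([Rogawski1990] §4.9 p. 55, Lemma 4.9.3 p. 56, Prop. 8.1.3 p. 116; [LabesseLanglands1979] §2; [Serre1979] Ch. X §1, Ch. XIV §3)

Topic `NumberTheory/Rogawski1990`; namespace `Literature.NumberTheory.Rogawski1990`.  THEOREMS ONLY (no definition, no instance, no notation, no named fact, no `sorry`);
kernel lane `--supports stmt-HodgeConjecture-24833`.  Cell `pub/hodgecm-mathlib` (D-0151), crux H413 = `stmt-HodgeConjecture-24833`; half A line LH4 (dyadic pay-down),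
LH4-plan (g6) WORD #99 price list, item **(P8b)**: the `|2|_w = 1` binder `h2` of ★ T5-u-TAME is DELETED.  HONEST LABEL: HC_CM is proved only modulo the 7 printed
citations (2 remaining named inputs: hLiu418 = stmt-HodgeConjecture-24832, h413 = stmt-HodgeConjecture-24833) until rung 0 closes; this file is count-neutral
((D-RAM)∕(D-UNR) stay PRINT; pays no organ, opens no road) and ROAD-INDEPENDENT (a statement about ★ `finTau` ∕ ★ `finExplicitDelta` alone).

THE ONE CHANGE.  ★ T5-u-TAME symmetrises `y = −χ_g(u)_w ∕ det g_w` (`σ_w y = y·r`, `r = det g_w ∕ u_w²` a deep norm-one unit) with the trace-one element `½` of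
`L_w ∕ L⁺_v`: `s := (1 + r)∕2`, `σ_w s = r⁻¹ s`, so `y·s = ι_w β` is `σ_w`-fixed and `μ_w(y) = μ_w(ι_w β)·μ_w(s)⁻¹ = (β, θ)_v` as soon as `μ_w(s) = 1`, i.e. as soon as `s`
is a unit deep enough for `μ_w`.  The only place where `|2|_w = 1` entered is `|s − 1|_w = |r − 1|_w ∕ |2|_w`: at a general place one simply asks `r` to be `|2|_w`-DEEPER,
`|r − 1|_w ≤ |2|_w · |ι_w ϖ_v|_w^{M₀}` (then `|s − 1|_w ≤ |ι_w ϖ_v|_w^{M₀}` and `1 + r ≠ 0` because `|r − 1|_w < |2|_w`).  No integrality of `½` is used (it acts on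
units `|2|`-close to `1`), so the census flag (F5) «no unit-trace element in a wild ORDER» does not bite.  In the head's `∃ M₀`-currency the extra depth is invisible:
`|2|_w = |ι_w ϖ_v|_w^a` with `a = ord_v 2` (`exists_valued_two_eq_valued_toPlace_heckeUniformizer_pow`), and `M₀ ↦ M₀ + a`.  Hence:

* §0 `exists_valued_two_eq_valued_toPlace_heckeUniformizer_pow` (`|2|_w = |ι_w ϖ_v|_w^a`), `valued_two_le_one`, `two_ne_zero_adicCompletion`.
* §1 CORE at any place: `localComponent_eq_hilbertSymbol_of_toPlace_eq_of_valued_le_two_mul` (★ CORE-tame with `h2 ↦ (hrd : |r − 1| ≤ |2|·|ι_w ϖ_v^{M₀}|)`),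
  `exists_units_toPlace_eq_mul_half_one_add_of_valued_lt_two` (★ with `h2 ↦ (hr2 : |r − 1| < |2|)`).
* §2 HEAD **`exists_forall_finTau_eq_hilbertSymbol_of_deep_anyPlace`** — ★ `exists_forall_finTau_eq_hilbertSymbol_of_deep` with `h2` DELETED, token for token otherwise —
  and `exists_units_toPlace_eq_symmDisc_of_deep_anyPlace` (★ with `h2 ↦` the `|2|`-deeper binders `hud hdd : … ≤ |2|·|ι_w ϖ_v^{M₀}|`).
* Sequel file `FinExplicitTransferFactorDeepTauAnyPlacePairs`: the `|2|`-carrying depth token (`|u_w² + det g_w|_w = |2|_w` EXACTLY for `|2|`-deep `γ_H`, census flag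
  (F4)), `Δ‴_v = (β, θ)_v·q_v^{−m}·κ_v` on matched deep pairs at any non-split place, its germ form and the scalar pull-outs (★ `…DeepTauTamePairs` with `h2` deleted).
The TAME heads (★, `h2`) are the specialisations `|2|_w = 1` of these and are NOT restated.

## References
* [Rogawski1990] J. D. Rogawski, *Automorphic Representations of Unitary Groups in Three Variables* (1990): §4.9 p. 55 (`τ`, `D_{G∕H}`, `μ|_{F^×} = ω_{E∕F}`), Lemma 4.9.3
  (4.9.2) p. 56, Prop. 8.1.3 p. 116.
* [LabesseLanglands1979] J.-P. Labesse, R. P. Langlands, *L-indistinguishability for SL(2)*, Canad. J. Math. 31 (1979): §2, (2.1)–(2.2).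
* [Serre1979] J.-P. Serre, *Local Fields*, GTM 67: Ch. X §1 (Hilbert 90), Ch. XIV §3 (the local symbol `(·, θ)_v`).
* [NeukirchANT1999] J. Neukirch, *Algebraic Number Theory* (1999): Ch. II §6 (`‖·‖_w = (N𝔓_w)^{−ord_w}`, `ord_w ∘ ι_w = e·ord_v`).
-/

set_option autoImplicit false

noncomputable section

open NumberField IsDedekindDomain Filter Topology Matrix

namespace Literature.NumberTheory.Rogawski1990

open Literature.NumberTheory.Automorphic Literature.NumberTheory.Automorphic.UnitaryGroup Literature.NumberTheory.GaloisRepresentations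
open Literature.NumberTheory.QuadraticForms

variable (L : Type) [Field L] [NumberField L] [IsCMField L] (v : HeightOneSpectrum (𝓞 ↥(maximalRealSubfield L)))
  (w : PlacesOver L v) (hw : IsCMField.complexConj L • w.1 = w.1)

/-! ## §0 `|2|_w = |ι_w ϖ_v|_w^a`: the extra depth a dyadic place asks for -/

section Two

omit [IsCMField L] in
/-- `2 ≠ 0` in `L_w` (characteristic `0`). [cite: NeukirchANT1999, Ch. II §6] -/
theorem two_ne_zero_adicCompletion : (2 : w.1.adicCompletion L) ≠ 0 := by
  rw [← map_ofNat (algebraMap L (w.1.adicCompletion L)) 2]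
  exact (map_ne_zero _).2 two_ne_zero

omit [IsCMField L] in
/-- `|2|_w ≤ 1`. [cite: NeukirchANT1999, Ch. II §6] -/
theorem valued_two_le_one : Valued.v (2 : w.1.adicCompletion L) ≤ 1 := by
  rw [show (2 : w.1.adicCompletion L) = 1 + 1 by norm_num]
  exact le_trans (Valuation.map_add _ _ _) (max_le (le_of_eq (Valuation.map_one _)) (le_of_eq (Valuation.map_one _)))

omit [IsCMField L] in
/-- **`|2|_w = |ι_w ϖ_v|_w^a` for some `a : ℕ`** (`a = ord_v 2`; `a = 0` exactly when `v ∤ 2`): the depth a dyadic place adds to every `½`-symmetrisation.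
[cite: NeukirchANT1999, Ch. II §6] -/
theorem exists_valued_two_eq_valued_toPlace_heckeUniformizer_pow :
    ∃ a : ℕ, Valued.v (2 : w.1.adicCompletion L) =
      Valued.v ((toPlace v w (HeckeCharacter.uniformizer ↥(maximalRealSubfield L) v : v.adicCompletion ↥(maximalRealSubfield L))) ^ a) := by
  have hb0 : (2 : v.adicCompletion ↥(maximalRealSubfield L)) ≠ 0 := by
    rw [← map_ofNat (algebraMap ↥(maximalRealSubfield L) (v.adicCompletion ↥(maximalRealSubfield L))) 2]
    exact (map_ne_zero _).2 two_ne_zero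
  have hb1 : Valued.v (2 : v.adicCompletion ↥(maximalRealSubfield L)) ≤ 1 := by
    rw [show (2 : v.adicCompletion ↥(maximalRealSubfield L)) = 1 + 1 by norm_num]
    exact le_trans (Valuation.map_add _ _ _) (max_le (le_of_eq (Valuation.map_one _)) (le_of_eq (Valuation.map_one _)))
  refine ⟨(-WithZero.log (Valued.v (2 : v.adicCompletion ↥(maximalRealSubfield L)))).toNat, ?_⟩
  have h := valued_eq_valued_uniformizer_pow_toNat L v hb0 hb1
  generalize (-WithZero.log (Valued.v (2 : v.adicCompletion ↥(maximalRealSubfield L)))).toNat = a at h ⊢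
  rw [← map_ofNat (toPlace v w) 2, valued_toPlace, h, ← valued_toPlace, map_pow]

end Two

/-! ## §1 CORE at any place: `μ_w(y) = (β, θ)_v` for `y` that is `σ`-fixed up to a `|2|`-deep norm-one unit, `β` its symmetrisation -/

section Core

variable (μ : HeckeCharacter L)
  (hμω : ∀ x : ideleGroup ↥(maximalRealSubfield L), μ (AdeleRing.ideleBaseChange ↥(maximalRealSubfield L) L x) = quadraticHeckeCharCM L x)

include hw hμω in
/-- **CORE at any non-split place** (★ CORE-tame `localComponent_eq_hilbertSymbol_of_toPlace_eq` with `h2` replaced by a `|2|`-deeper `r`): under the guard, with `M₀ ≥ 1` a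
level on which `μ_w` is trivial (`hM₀`): if `y ≠ 0`, `|r − 1|_w ≤ |2|_w·|ι_w ϖ_v^{M₀}|_w` and `β ∈ L⁺_vˣ` has `ι_w β = y·(1 + r)∕2`, then **`μ_w(y) = (β, θ)_v`** (`s := (1+r)∕2` has
`|s − 1|_w = |r − 1|_w∕|2|_w ≤ |ι_w ϖ_v^{M₀}|_w`, so `μ_w(s) = 1`, `y = ι_w β · s⁻¹`, `μ_w(ι_w β) = (β, θ)_v` ★). [cite: Rogawski1990, §4.9 p. 55; Lemma 4.9.3 (4.9.2) p. 56]
[cite: Serre1979, Ch. XIV §3] -/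
theorem localComponent_eq_hilbertSymbol_of_toPlace_eq_of_valued_le_two_mul
    {M₀ : ℕ} (hM₀ : ∀ (s : w.1.adicCompletion L) (hs : s ≠ 0),
      Valued.v (s - 1) ≤ Valued.v ((toPlace v w (HeckeCharacter.uniformizer ↥(maximalRealSubfield L) v : v.adicCompletion ↥(maximalRealSubfield L))) ^ M₀) →
      μ.localComponent w.1 (Units.mk0 s hs) = 1)
    {y r : w.1.adicCompletion L} (hy0 : y ≠ 0)
    (hrd : Valued.v (r - 1) ≤ Valued.v (2 : w.1.adicCompletion L) *
      Valued.v ((toPlace v w (HeckeCharacter.uniformizer ↥(maximalRealSubfield L) v : v.adicCompletion ↥(maximalRealSubfield L))) ^ M₀))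
    (hr2 : Valued.v (r - 1) < Valued.v (2 : w.1.adicCompletion L))
    (β : (v.adicCompletion ↥(maximalRealSubfield L))ˣ) (hβ : toPlace v w (β : v.adicCompletion ↥(maximalRealSubfield L)) = y * ((1 + r) / 2)) :
    ((μ.localComponent w.1 (Units.mk0 y hy0) : ℂˣ) : ℂ) =
      (hilbertSymbol (v.adicCompletion ↥(maximalRealSubfield L)) (β : v.adicCompletion ↥(maximalRealSubfield L))
        (algebraMap ↥(maximalRealSubfield L) _ ((cmQuadraticGenerator L : 𝓞 ↥(maximalRealSubfield L)) : ↥(maximalRealSubfield L))) : ℂ) := by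
  classical
  set ϖ : w.1.adicCompletion L := toPlace v w (HeckeCharacter.uniformizer ↥(maximalRealSubfield L) v : v.adicCompletion ↥(maximalRealSubfield L)) with hϖdef
  have h20 : (2 : w.1.adicCompletion L) ≠ 0 := two_ne_zero_adicCompletion L v w
  have hv2 : 0 < Valued.v (2 : w.1.adicCompletion L) := zero_lt_iff.2 ((Valuation.ne_zero_iff _).2 h20)
  -- `s := (1 + r)/2`, a deep unit
  set s : w.1.adicCompletion L := (1 + r) / 2 with hsdef
  have hs1 : s - 1 = (r - 1) / 2 := by rw [hsdef]; field_simp; ring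
  have hsv1 : Valued.v (s - 1) ≤ Valued.v (ϖ ^ M₀) := by
    rw [hs1, Valuation.map_div]
    exact (div_le_iff₀ hv2).2 (by rw [mul_comm]; exact hrd)
  have hsvlt : Valued.v (s - 1) < 1 := by
    rw [hs1, Valuation.map_div]
    exact (div_lt_one₀ hv2).2 hr2
  have hvs : Valued.v s = 1 := by
    have h := Valuation.map_one_add_of_lt (Valued.v : Valuation (w.1.adicCompletion L) _) hsvlt
    rwa [add_sub_cancel] at h
  have hs0 : s ≠ 0 := fun h0 => by rw [h0, map_zero] at hvs; exact zero_ne_one hvs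
  have hμs : μ.localComponent w.1 (Units.mk0 s hs0) = 1 := hM₀ s hs0 hsv1
  -- `y = ι β · s⁻¹`
  have hyu : Units.mk0 y hy0 =
      Units.map (toPlace v w : v.adicCompletion ↥(maximalRealSubfield L) →* w.1.adicCompletion L) β * (Units.mk0 s hs0)⁻¹ :=
    Units.ext (by rw [Units.val_mul, Units.val_inv_eq_inv_val, Units.val_mk0, Units.val_mk0, Units.coe_map, MonoidHom.coe_coe, hβ, mul_inv_cancel_right₀ hs0])
  rw [hyu, map_mul, map_inv, hμs, inv_one, mul_one, localComponent_map_toPlace_eq_hilbertSymbol L v w hw μ hμω β]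

include hw in
/-- **THE SYMMETRISATION COMES FROM `L⁺_v`, at any non-split place** (★ `exists_units_toPlace_eq_mul_half_one_add` with `h2 ↦ (hr2 : |r − 1|_w < |2|_w)`): if `y ≠ 0`,
`σ_w y = y·r` with `σ_w r · r = 1` and `|r − 1|_w < |2|_w`, then `y·(1 + r)∕2 ≠ 0` is `σ_w`-fixed (`1 + r ≠ 0` since `|(−1) − 1|_w = |2|_w`; `σ((1+r)∕2) = r⁻¹(1+r)∕2` is
characteristic-`0` algebra), hence `= ι_w β` for a `β ∈ L⁺_vˣ` (★ `exists_toPlace_eq_of_galAdicCompletionMap_eq`).  Hilbert 90 near `1` with the trace-one element `½`,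
paid for by `|2|_w` of extra depth. [cite: Serre1979, Ch. X §1] [cite: Rogawski1990, §4.9 p. 55] -/
theorem exists_units_toPlace_eq_mul_half_one_add_of_valued_lt_two
    {y r : w.1.adicCompletion L} (hy0 : y ≠ 0)
    (hσy : galAdicCompletionMap (L := L) (IsCMField.complexConj L) hw y = y * r)
    (hr : galAdicCompletionMap (L := L) (IsCMField.complexConj L) hw r * r = 1)
    (hr2 : Valued.v (r - 1) < Valued.v (2 : w.1.adicCompletion L)) :
    ∃ β : (v.adicCompletion ↥(maximalRealSubfield L))ˣ, toPlace v w (β : v.adicCompletion ↥(maximalRealSubfield L)) = y * ((1 + r) / 2) := by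
  classical
  have hc1 : IsCMField.complexConj L ≠ 1 := IsCMField.complexConj_ne_one L
  set σ := galAdicCompletionMap (L := L) (IsCMField.complexConj L) hw with hσdef
  have h20 : (2 : w.1.adicCompletion L) ≠ 0 := two_ne_zero_adicCompletion L v w
  -- `r` is a unit with `σ r = r⁻¹`, and `1 + r ≠ 0`
  have hvr1 : Valued.v (r - 1) < 1 := lt_of_lt_of_le hr2 (valued_two_le_one L v w)
  have hvr : Valued.v r = 1 := by
    have h := Valuation.map_one_add_of_lt (Valued.v : Valuation (w.1.adicCompletion L) _) hvr1
    rwa [add_sub_cancel] at h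
  have hr0 : r ≠ 0 := fun h0 => by rw [h0, map_zero] at hvr; exact zero_ne_one hvr
  have hσr : σ r = r⁻¹ := eq_inv_of_mul_eq_one_left hr
  have h1r : 1 + r ≠ 0 := by
    intro h
    have hr' : r - 1 = -2 := by linear_combination h
    rw [hr', Valuation.map_neg] at hr2
    exact lt_irrefl _ hr2
  -- `σ` fixes `y (1 + r)/2`
  have hσ2 : σ 2 = 2 := map_ofNat σ 2
  have hfix : σ (y * ((1 + r) / 2)) = y * ((1 + r) / 2) := by
    rw [map_mul, map_div₀, map_add, map_one, hσ2, hσy, hσr]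
    field_simp
    ring
  obtain ⟨p, hp⟩ := exists_toPlace_eq_of_galAdicCompletionMap_eq (IsCMField.complexConj L) w hc1 hw _ hfix
  have hp0 : p ≠ 0 := by
    intro h0
    rw [h0, map_zero] at hp
    exact mul_ne_zero hy0 (div_ne_zero h1r h20) hp.symm
  exact ⟨Units.mk0 p hp0, by rw [Units.val_mk0, hp]⟩

end Core

/-! ## §2 HEAD: `τ_v(γ_H) = (β(γ_H), θ)_v` for every deep `γ_H`, at EVERY non-split place -/

section Head

variable (μ : HeckeCharacter L)
  (hμω : ∀ x : ideleGroup ↥(maximalRealSubfield L), μ (AdeleRing.ideleBaseChange ↥(maximalRealSubfield L) L x) = quadraticHeckeCharCM L x)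

include hw hμω in
/-- **HEAD (T5-u AT ANY NON-SPLIT PLACE) — `τ_v(γ_H) = (β(γ_H), θ)_v` FOR EVERY DEEP `γ_H`, ALL TORUS TYPES, DYADIC PLACES INCLUDED.**  At a non-split place `v` of `L⁺`
(`w ∣ v`, ANY residue characteristic), for a Hecke character `μ` with print's guard `μ|_{𝕀_{L⁺}} = ω_{L∕L⁺}`, there is a level `M₀ ≥ 1` such that for every `γ_H = (g, u) ∈ H_v`
with `χ_g(u)_w ≠ 0`, `|u_w − 1|_w ≤ |ι_w ϖ_v|_w^{M₀}`, `|det g_w − 1|_w ≤ |ι_w ϖ_v|_w^{M₀}`, and every `β ∈ L⁺_vˣ` with `ι_w β = −χ_g(u)_w·(u_w² + det g_w)∕(2·u_w²·det g_w)`: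
**`τ_v(γ_H) = (β, θ)_v`**.  This is ★ `exists_forall_finTau_eq_hilbertSymbol_of_deep` with its binder `h2 : |2|_w = 1` DELETED (the level is `M₀ + ord_v 2` where ★ had
`M₀`; the tame head is the case `ord_v 2 = 0` and is not restated). [cite: Rogawski1990, §4.9 p. 55; Lemma 4.9.3 (4.9.2) p. 56; Prop. 8.1.3 p. 116]
[cite: LabesseLanglands1979, §2 (2.1)–(2.2)] -/
theorem exists_forall_finTau_eq_hilbertSymbol_of_deep_anyPlace :
    ∃ M₀ : ℕ, 1 ≤ M₀ ∧
      ∀ (γH : (cmDatum L 2 (Matrix.of fun i j : Fin 2 => if i.val + j.val + 1 = 2 then (1 : L) else 0)).Local v ×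
          (cmDatum L 1 (Matrix.of fun i j : Fin 1 => if i.val + j.val + 1 = 1 then (1 : L) else 0)).Local v),
        ((finCharpolyTwo L v γH).eval (finGammaTwo L v γH)) w ≠ 0 →
        Valued.v (finGammaTwo L v γH w - 1) ≤
          Valued.v ((toPlace v w (HeckeCharacter.uniformizer ↥(maximalRealSubfield L) v : v.adicCompletion ↥(maximalRealSubfield L))) ^ M₀) →
        Valued.v (((γH.1.val.val : Matrix (Fin 2) (Fin 2) (LocalRing L v)).map
            (Pi.evalRingHom (fun w' : PlacesOver L v => w'.1.adicCompletion L) w)).det - 1) ≤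
          Valued.v ((toPlace v w (HeckeCharacter.uniformizer ↥(maximalRealSubfield L) v : v.adicCompletion ↥(maximalRealSubfield L))) ^ M₀) →
        ∀ β : (v.adicCompletion ↥(maximalRealSubfield L))ˣ,
          toPlace v w (β : v.adicCompletion ↥(maximalRealSubfield L)) =
            -(((finCharpolyTwo L v γH).eval (finGammaTwo L v γH)) w *
                (finGammaTwo L v γH w ^ 2 +
                  ((γH.1.val.val : Matrix (Fin 2) (Fin 2) (LocalRing L v)).map (Pi.evalRingHom (fun w' : PlacesOver L v => w'.1.adicCompletion L) w)).det)) /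
              (2 * finGammaTwo L v γH w ^ 2 *
                ((γH.1.val.val : Matrix (Fin 2) (Fin 2) (LocalRing L v)).map (Pi.evalRingHom (fun w' : PlacesOver L v => w'.1.adicCompletion L) w)).det) →
          finTau L v γH μ =
            (hilbertSymbol (v.adicCompletion ↥(maximalRealSubfield L)) (β : v.adicCompletion ↥(maximalRealSubfield L))
              (algebraMap ↥(maximalRealSubfield L) _ ((cmQuadraticGenerator L : 𝓞 ↥(maximalRealSubfield L)) : ↥(maximalRealSubfield L))) : ℂ) := by
  classical
  haveI : Algebra.IsQuadraticExtension ↥(maximalRealSubfield L) L := IsCMField.isQuadraticExtension L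
  have hc1 : IsCMField.complexConj L ≠ 1 := IsCMField.complexConj_ne_one L
  haveI hv : Subsingleton (PlacesOver L v) := PlacesOver.subsingleton_of_smul_eq (IsCMField.complexConj L) hc1 w hw
  obtain ⟨M₀, hM₁, hM₀⟩ := exists_forall_localComponent_eq_one_of_valued_sub_one_le L v w μ
  obtain ⟨a, ha⟩ := exists_valued_two_eq_valued_toPlace_heckeUniformizer_pow L v w
  refine ⟨M₀ + a, by omega, fun γH hχ0 hud hdd β hβ => ?_⟩
  set σ := galAdicCompletionMap (L := L) (IsCMField.complexConj L) hw with hσdef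
  set ϖ : w.1.adicCompletion L := toPlace v w (HeckeCharacter.uniformizer ↥(maximalRealSubfield L) v : v.adicCompletion ↥(maximalRealSubfield L)) with hϖdef
  set u := finGammaTwo L v γH w with hudef
  set χw := ((finCharpolyTwo L v γH).eval (finGammaTwo L v γH)) w with hχwdef
  set d := ((γH.1.val.val : Matrix (Fin 2) (Fin 2) (LocalRing L v)).map (Pi.evalRingHom (fun w' : PlacesOver L v => w'.1.adicCompletion L) w)).det with hddef
  have hϖM1 : Valued.v (ϖ ^ M₀) < 1 := valued_toPlace_heckeUniformizer_pow_lt_one L v w hM₁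
  have h20 : (2 : w.1.adicCompletion L) ≠ 0 := two_ne_zero_adicCompletion L v w
  have hv2 : 0 < Valued.v (2 : w.1.adicCompletion L) := zero_lt_iff.2 ((Valuation.ne_zero_iff _).2 h20)
  have h2le : Valued.v (2 : w.1.adicCompletion L) ≤ 1 := valued_two_le_one L v w
  -- the extra depth: `|ϖ^{M₀ + a}| = |2|·|ϖ^{M₀}| ≤ |ϖ^{M₀}|`, and `< |2|`
  have hϖa : Valued.v (ϖ ^ (M₀ + a)) = Valued.v (2 : w.1.adicCompletion L) * Valued.v (ϖ ^ M₀) := by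
    rw [pow_add, Valuation.map_mul, ← ha, mul_comm]
  have hϖa1 : Valued.v (ϖ ^ (M₀ + a)) ≤ Valued.v (ϖ ^ M₀) := by
    rw [hϖa]; exact mul_le_of_le_one_left' h2le
  have hϖa2 : Valued.v (ϖ ^ (M₀ + a)) < Valued.v (2 : w.1.adicCompletion L) := by
    rw [hϖa]
    have h := mul_lt_mul_of_pos_left hϖM1 hv2
    rwa [mul_one] at h
  have hud' : Valued.v (u - 1) ≤ Valued.v (ϖ ^ M₀) := le_trans hud hϖa1
  have hdd' : Valued.v (d - 1) ≤ Valued.v (ϖ ^ M₀) := le_trans hdd hϖa1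
  -- units: `u`, `d`
  have hσu : σ u * u = 1 := by
    have h := congrArg (fun y : LocalRing L v => y w) (conjLocal_finGammaTwo_mul_finGammaTwo L v γH)
    simpa only [Pi.mul_apply, Pi.one_apply, conjLocal_apply_eq_galAdicCompletionMap L v w hw] using h
  have hσd : σ d * d = 1 := galAdicCompletionMap_det_mul_det_eq_one L v w hw γH
  have hvu : Valued.v u = 1 := by
    have hlt : Valued.v (u - 1) < 1 := lt_of_le_of_lt hud' hϖM1
    have h := Valuation.map_one_add_of_lt (Valued.v : Valuation (w.1.adicCompletion L) _) hlt
    rwa [add_sub_cancel] at h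
  have hu0 : u ≠ 0 := fun h0 => by rw [h0, map_zero] at hvu; exact zero_ne_one hvu
  have hvd : Valued.v d = 1 := by
    have hlt : Valued.v (d - 1) < 1 := lt_of_le_of_lt hdd' hϖM1
    have h := Valuation.map_one_add_of_lt (Valued.v : Valuation (w.1.adicCompletion L) _) hlt
    rwa [add_sub_cancel] at h
  have hd0 : d ≠ 0 := fun h0 => by rw [h0, map_zero] at hvd; exact zero_ne_one hvd
  have hχu : IsUnit ((finCharpolyTwo L v γH).eval (finGammaTwo L v γH)) := by
    refine isUnit_localRing_of_ne_zero_of_subsingleton L v hv fun h0 => hχ0 ?_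
    rw [hχwdef, h0, Pi.zero_apply]
  -- `τ = μ_w(u) · μ_w(y)⁻¹`, `y = t_w`
  rw [finTau_eq_localComponent_of_nonsplit L v γH w hw μ hχu]
  have hy : finTauArg L v γH w = -χw * d⁻¹ := finTauArg_apply L v γH w
  have hy0 : finTauArg L v γH w ≠ 0 := by rw [hy]; exact mul_ne_zero (neg_ne_zero.2 hχ0) (inv_ne_zero hd0)
  have hunitu : MulEquiv.piUnits (isUnit_finGammaTwo L v γH).unit w = Units.mk0 u hu0 := Units.ext rfl
  have hunity : MulEquiv.piUnits (isUnit_finTauArg_of_isUnit L v γH hχu).unit w = Units.mk0 (finTauArg L v γH w) hy0 := Units.ext rfl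
  rw [hunitu, hunity, hM₀ u hu0 hud', Units.val_one, one_mul]
  -- the core with `r := d / u²`: `ι β = y (1 + r)/2`, `r` is `|2|`-deeper
  have hrd0 : Valued.v (d / u ^ 2 - 1) ≤ Valued.v (ϖ ^ (M₀ + a)) := by
    have hsub : d / u ^ 2 - 1 = (d - 1 - (u - 1) * (u + 1)) / u ^ 2 := by field_simp; ring
    rw [hsub, Valuation.map_div, Valuation.map_pow, hvu, one_pow, div_one]
    refine le_trans (Valuation.map_sub _ _ _) (max_le hdd ?_)
    rw [Valuation.map_mul]
    calc Valued.v (u - 1) * Valued.v (u + 1) ≤ Valued.v (ϖ ^ (M₀ + a)) * 1 := by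
          gcongr
          exact le_trans (Valuation.map_add _ _ _) (max_le hvu.le (le_of_eq (Valuation.map_one _)))
      _ = Valued.v (ϖ ^ (M₀ + a)) := mul_one _
  have hrd : Valued.v (d / u ^ 2 - 1) ≤ Valued.v (2 : w.1.adicCompletion L) * Valued.v (ϖ ^ M₀) := hϖa ▸ hrd0
  have hr2 : Valued.v (d / u ^ 2 - 1) < Valued.v (2 : w.1.adicCompletion L) := lt_of_le_of_lt hrd0 hϖa2
  have hβ' : toPlace v w (β : v.adicCompletion ↥(maximalRealSubfield L)) = finTauArg L v γH w * ((1 + d / u ^ 2) / 2) := by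
    rw [hβ, hy]
    field_simp
  rw [localComponent_eq_hilbertSymbol_of_toPlace_eq_of_valued_le_two_mul L v w hw μ hμω hM₀ hy0 hrd hr2 β hβ']
  -- `(β, θ)_v = ±1` is its own inverse
  rcases hilbertSymbol_eq_one_or_eq_neg_one (β : v.adicCompletion ↥(maximalRealSubfield L))
      (algebraMap ↥(maximalRealSubfield L) _ ((cmQuadraticGenerator L : 𝓞 ↥(maximalRealSubfield L)) : ↥(maximalRealSubfield L))) with h | h <;>
    simp [h]

include hw in
/-- **THE SYMMETRISED DISCRIMINANT OF A `|2|`-DEEP `γ_H` COMES FROM `L⁺_v`, at any non-split place** (★ `exists_units_toPlace_eq_symmDisc_of_deep` with `h2 ↦` the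
`|2|`-deeper binders): for `M₀ ≥ 1` and `γ_H = (g, u)` with `χ_g(u)_w ≠ 0`, `|u_w − 1|_w, |det g_w − 1|_w ≤ |2|_w·|ι_w ϖ_v|_w^{M₀}` there is `β ∈ L⁺_vˣ` with
`ι_w β = −χ_g(u)_w·(u_w² + det g_w)∕(2·u_w²·det g_w)`. [cite: Rogawski1990, §4.9 p. 55] [cite: Serre1979, Ch. X §1] -/
theorem exists_units_toPlace_eq_symmDisc_of_deep_anyPlace {M₀ : ℕ} (hM₁ : 1 ≤ M₀)
    (γH : (cmDatum L 2 (Matrix.of fun i j : Fin 2 => if i.val + j.val + 1 = 2 then (1 : L) else 0)).Local v ×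
      (cmDatum L 1 (Matrix.of fun i j : Fin 1 => if i.val + j.val + 1 = 1 then (1 : L) else 0)).Local v)
    (hχ0 : ((finCharpolyTwo L v γH).eval (finGammaTwo L v γH)) w ≠ 0)
    (hud : Valued.v (finGammaTwo L v γH w - 1) ≤ Valued.v (2 : w.1.adicCompletion L) *
      Valued.v ((toPlace v w (HeckeCharacter.uniformizer ↥(maximalRealSubfield L) v : v.adicCompletion ↥(maximalRealSubfield L))) ^ M₀))
    (hdd : Valued.v (((γH.1.val.val : Matrix (Fin 2) (Fin 2) (LocalRing L v)).map
        (Pi.evalRingHom (fun w' : PlacesOver L v => w'.1.adicCompletion L) w)).det - 1) ≤ Valued.v (2 : w.1.adicCompletion L) *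
      Valued.v ((toPlace v w (HeckeCharacter.uniformizer ↥(maximalRealSubfield L) v : v.adicCompletion ↥(maximalRealSubfield L))) ^ M₀)) :
    ∃ β : (v.adicCompletion ↥(maximalRealSubfield L))ˣ,
      toPlace v w (β : v.adicCompletion ↥(maximalRealSubfield L)) =
        -(((finCharpolyTwo L v γH).eval (finGammaTwo L v γH)) w *
            (finGammaTwo L v γH w ^ 2 +
              ((γH.1.val.val : Matrix (Fin 2) (Fin 2) (LocalRing L v)).map (Pi.evalRingHom (fun w' : PlacesOver L v => w'.1.adicCompletion L) w)).det)) /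
          (2 * finGammaTwo L v γH w ^ 2 *
            ((γH.1.val.val : Matrix (Fin 2) (Fin 2) (LocalRing L v)).map (Pi.evalRingHom (fun w' : PlacesOver L v => w'.1.adicCompletion L) w)).det) := by
  classical
  set σ := galAdicCompletionMap (L := L) (IsCMField.complexConj L) hw with hσdef
  set ϖ : w.1.adicCompletion L := toPlace v w (HeckeCharacter.uniformizer ↥(maximalRealSubfield L) v : v.adicCompletion ↥(maximalRealSubfield L)) with hϖdef
  set u := finGammaTwo L v γH w with hudef
  set χw := ((finCharpolyTwo L v γH).eval (finGammaTwo L v γH)) w with hχwdef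
  set d := ((γH.1.val.val : Matrix (Fin 2) (Fin 2) (LocalRing L v)).map (Pi.evalRingHom (fun w' : PlacesOver L v => w'.1.adicCompletion L) w)).det with hddef
  have hϖM1 : Valued.v (ϖ ^ M₀) < 1 := valued_toPlace_heckeUniformizer_pow_lt_one L v w hM₁
  have h20 : (2 : w.1.adicCompletion L) ≠ 0 := two_ne_zero_adicCompletion L v w
  have hv2 : 0 < Valued.v (2 : w.1.adicCompletion L) := zero_lt_iff.2 ((Valuation.ne_zero_iff _).2 h20)
  have h2le : Valued.v (2 : w.1.adicCompletion L) ≤ 1 := valued_two_le_one L v w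
  have h2M : Valued.v (2 : w.1.adicCompletion L) * Valued.v (ϖ ^ M₀) < Valued.v (2 : w.1.adicCompletion L) := by
    have h := mul_lt_mul_of_pos_left hϖM1 hv2
    rwa [mul_one] at h
  have hud' : Valued.v (u - 1) ≤ Valued.v (ϖ ^ M₀) := le_trans hud (mul_le_of_le_one_left' h2le)
  have hdd' : Valued.v (d - 1) ≤ Valued.v (ϖ ^ M₀) := le_trans hdd (mul_le_of_le_one_left' h2le)
  have hσu : σ u * u = 1 := by
    have h := congrArg (fun y : LocalRing L v => y w) (conjLocal_finGammaTwo_mul_finGammaTwo L v γH)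
    simpa only [Pi.mul_apply, Pi.one_apply, conjLocal_apply_eq_galAdicCompletionMap L v w hw] using h
  have hσd : σ d * d = 1 := galAdicCompletionMap_det_mul_det_eq_one L v w hw γH
  have hvu : Valued.v u = 1 := by
    have hlt : Valued.v (u - 1) < 1 := lt_of_le_of_lt hud' hϖM1
    have h := Valuation.map_one_add_of_lt (Valued.v : Valuation (w.1.adicCompletion L) _) hlt
    rwa [add_sub_cancel] at h
  have hu0 : u ≠ 0 := fun h0 => by rw [h0, map_zero] at hvu; exact zero_ne_one hvu
  have hvd : Valued.v d = 1 := by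
    have hlt : Valued.v (d - 1) < 1 := lt_of_le_of_lt hdd' hϖM1
    have h := Valuation.map_one_add_of_lt (Valued.v : Valuation (w.1.adicCompletion L) _) hlt
    rwa [add_sub_cancel] at h
  have hd0 : d ≠ 0 := fun h0 => by rw [h0, map_zero] at hvd; exact zero_ne_one hvd
  have hy : finTauArg L v γH w = -χw * d⁻¹ := finTauArg_apply L v γH w
  have hy0 : finTauArg L v γH w ≠ 0 := by rw [hy]; exact mul_ne_zero (neg_ne_zero.2 hχ0) (inv_ne_zero hd0)
  have hσy : σ (finTauArg L v γH w) = finTauArg L v γH w * (d / u ^ 2) := galAdicCompletionMap_finTauArg_apply L v w hw γH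
  have hr : σ (d / u ^ 2) * (d / u ^ 2) = 1 := by
    rw [map_div₀, map_pow]
    have h1 : σ d = d⁻¹ := eq_inv_of_mul_eq_one_left hσd
    have h2' : σ u = u⁻¹ := eq_inv_of_mul_eq_one_left hσu
    rw [h1, h2']
    field_simp
  have hrd : Valued.v (d / u ^ 2 - 1) ≤ Valued.v (2 : w.1.adicCompletion L) * Valued.v (ϖ ^ M₀) := by
    have hsub : d / u ^ 2 - 1 = (d - 1 - (u - 1) * (u + 1)) / u ^ 2 := by field_simp; ring
    rw [hsub, Valuation.map_div, Valuation.map_pow, hvu, one_pow, div_one]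
    refine le_trans (Valuation.map_sub _ _ _) (max_le hdd ?_)
    rw [Valuation.map_mul]
    calc Valued.v (u - 1) * Valued.v (u + 1) ≤ (Valued.v (2 : w.1.adicCompletion L) * Valued.v (ϖ ^ M₀)) * 1 := by
          gcongr
          exact le_trans (Valuation.map_add _ _ _) (max_le hvu.le (le_of_eq (Valuation.map_one _)))
      _ = Valued.v (2 : w.1.adicCompletion L) * Valued.v (ϖ ^ M₀) := mul_one _
  have hr2 : Valued.v (d / u ^ 2 - 1) < Valued.v (2 : w.1.adicCompletion L) := lt_of_le_of_lt hrd h2M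
  obtain ⟨β, hβ⟩ := exists_units_toPlace_eq_mul_half_one_add_of_valued_lt_two L v w hw hy0 hσy hr hr2
  refine ⟨β, ?_⟩
  rw [hβ, hy]
  field_simp

end Head

end Literature.NumberTheory.Rogawski1990

end
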